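import Literature.NumberTheory.EllipticCurves.Kato2004.IwasawaH1TorsionFreeProofs
import Literature.NumberTheory.EllipticCurves.Kato2004.IwasawaCohomologyCoeffNewform
import Literature.NumberTheory.EllipticCurves.GreenbergSelmerCharIdealPrincipalProofs
import Literature.NumberTheory.EllipticCurves.PadicCoeffIntegersFrobeniusData
import Literature.NumberTheory.EllipticCurves.NewformsCoeffFieldHolds
import HarnessLib

/-!
# Kato 2004 (Astérisque 295) Thm. 12.4 (2), the CONSTANT part, WITH COEFFICIENTS: the pinned Iwasawa
# cohomology `𝐇¹_Γ(T) = lim←_n H¹(ℤ_n[1/p], T)` over `A⟦X⟧` has no `a`-torsion — in particular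
# `𝐇¹_Γ(T_ρ)` is a torsion-free `𝒪_λ`-module for every lattice `ρ : Γ_ℚ → GL_n(𝒪_λ)`, every prime `p`

Topic `NumberTheory/EllipticCurves`, sub-directory `Kato2004` (namespace = path).  THEOREMS ONLY (no
definition, no named fact, no `instance`, no `sorry`).  Sibling proof file of the pin
`Kato2004/IwasawaCohomologyCoeff.lean` (`IwasawaH1DataCoeff T p κ γ`, an `A⟦X⟧`-module) and of the named
fact `Kato2004.thm12_4_newform` (`Kato2004/IwasawaCohomologyCoeffNewform.lean`, print leaf K0b of route
`ResidualThetaTransportAtTwo`, item stmt-BirchSwinnertonDyer-24115, conjunct of `stub_printInputs` of crux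
stmt-BirchSwinnertonDyer-22608); the coefficient-generic twin of the tree's
`Kato2004/IwasawaH1TorsionFreeProofs.lean` (`T = T_pW`, `A = ℤ_p`, `a = p`), whose `coresLe_resLe` and
`resLe_oneCocycleClass_eq_of_forall_apply` it reuses.  Seat `bsd-wall-tp2-p2x-w2` g23.  It proves,
UNCONDITIONALLY, the part of the clause `Module.IsTorsionFree Λ_𝒪 𝐇¹_Γ(T_ρ)` of `thm12_4_newform` that
concerns the CONSTANTS `a ∈ 𝒪 ⊂ 𝒪⟦X⟧`:

* §1 `exists_contOneCocycles_smul_eq_coboundary` — cochain engine: `g ↦ a⁻¹(g m − m)` is a continuous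
  cocycle on `U` when `a` acts by a topological embedding and `m` is `U`-fixed modulo `a • M`.
* §2 `exists_forall_fixedMod_of_succ`, `exists_forall_layerCores_eq_smul` — one step along the tower
  (`M` Noetherian): `{m | m is Γ_n-fixed mod a • M}` stabilises (`n ≥ n₀`), and then
  `Cor : H¹(ℚ_{n+1}, T)[a] → p • H¹(ℚ_n, T)[a]` (`a c = ∂m`, `d = a⁻¹∂m` on `Γ_n`, `res [d] = [c]`,
  `Cor res = (Γ_n : Γ_{n+1}) = p`).
* §3 **`IwasawaH1DataCoeff.eq_zero_of_C_smul_eq_zero`** / `isSMulRegular_C` — for EVERY pin (any `A`,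
  `M` Noetherian, `a` acting by an embedding, `p^k ∈ (a)`): `C(a) • x = 0 → x = 0`.
* §4 `𝒪 = padicCoeffIntegers S`, `ℚ_p(S)/ℚ_p` finite: `exists_pow_natCast_mem_span`, `isEmbedding_smul_pi`.
* §5 **`eq_zero_of_C_smul_eq_zero_of_ne_zero`** / `isSMulRegular_C_of_ne_zero` /
  `isTorsionFree_compHom_C` — for every `ρ : Γ_ℚ → GL_n(𝒪)`, `κ`, `γ`, pin `I`: `𝐇¹_Γ(T_ρ)` has NO
  `𝒪`-TORSION; §6 `eq_zero_of_C_smul_eq_zero_newform` restates it on the binders of `thm12_4_newform`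
  (its newform / Frobenius / cyclotomicity hypotheses are NOT used).

HONEST FRAMING.  This is the `𝒪`-torsion half of Kato's "`𝐇¹(T)` is a torsion free `Λ`-module"
(Thm. 12.4 (2)), by the levelwise mechanism of §13.8 ("`lim← H⁰ = 0`": the norm maps on the stabilised
`(T/a)^{Γ_n}` are multiplication by `p`), for ANY `p`-adic lattice — no arithmetic input.  NOT here: the
`Λ_𝒪`-torsion half (classes killed by a distinguished polynomial), which is `𝐇¹_{Λ-tors} ↪ T^{Gal(ℚ̄/ℚ_∞)}
⊗ …` and needs, for `T_ρ ⊂ V_{F_λ}(g)(1)`, «`V_g` has no `Gal(ℚ̄/ℚ_∞)`-fixed line» (Ribet / purity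
(14.10.5)) plus a Shapiro-type comparison `𝐇¹ ≅ H¹(ℤ[1/p], T ⊗ Λ^ι)`; nor (12.2.1), nor the rank.
`thm12_4_newform` (K0b) stays a named fact; BSD is not advanced by this file.

Printed (K. Kato, Astérisque 295): **Thm. 12.4 (2) [p. 221]** "`𝐇¹(T)` is a torsion free `Λ`-module"
(`T` any `Gal(ℚ̄/ℚ)`-stable `O_λ`-lattice of `V_{F_λ}(f)`); proof **§13.8 [pp. 228–229]**
("`𝐇¹(T)/x𝐇¹(T) ⊂ H¹(ℤ[1/p], T ⊗ Λ/xΛ)` … `lim← H⁰(…) = 0`"); **§12.2 [p. 220]** (trace maps).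

## References

* [Kato2004Asterisque] K. Kato, *p-adic Hodge theory and values of zeta functions of modular forms*,
  Astérisque 295 (2004) 117–290: Thm. 12.4 (2) (p. 221), §12.2 (p. 220), §13.8 (pp. 228–229).
* [SerreGaloisCohomology1997] J.-P. Serre, *Galois Cohomology* (1997), I §2.2, I §2.4 Prop. 9.
* [EmertonPollackWeston2006] M. Emerton, R. Pollack, T. Weston, Invent. Math. 163 (2006), §3.1 (`𝒪`).
-/

noncomputable section

open scoped NumberField
open Field CategoryTheory Topology
open Literature.NumberTheory.GaloisRepresentations
open Literature.NumberTheory.EllipticCurves Literature.NumberTheory.EllipticCurves.Kato2004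
open Literature.NumberTheory.EllipticCurves.Kato2004.EulerSystemValues

universe u

namespace Literature.NumberTheory.EllipticCurves.Kato2004

/-! ## §1 The cochain engine: dividing a coboundary by a scalar -/

namespace IwasawaH1CoeffTorsionFree

section Engine

variable {A : Type*} [CommRing A] [TopologicalSpace A]
variable {Γ : Type u} [Group Γ] [TopologicalSpace Γ]
variable {M : Type u} [AddCommGroup M] [Module A M] [TopologicalSpace M] [IsTopologicalAddGroup M]
  [ContinuousSMul A M]
variable (ρ : ContinuousRep Γ A M) (U : Subgroup Γ)

/-- **The cocycle `a⁻¹ ∂m`.**  For a jointly continuous representation `ρ` of `Γ` on `M`, a scalar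
`a ∈ A` acting on `M` by a topological EMBEDDING, a subgroup `U ≤ Γ` and `m ∈ M` which is `U`-fixed modulo
`a • M`, the map `g ↦ a⁻¹(g m − m)` is a CONTINUOUS crossed homomorphism `d` on `U` (`a • d g = g m − m`):
continuity and the cocycle identity are checked after applying the embedding `a •`.  The cochain form of
the connecting map `(M/aM)^U → H¹(U, M)[a]` of `0 → M →(a) M → M/aM → 0` (Serre, I §2.2).
[cite: SerreGaloisCohomology1997, I §2.2] -/
theorem exists_contOneCocycles_smul_eq_coboundary (a : A) (ha : IsEmbedding fun v : M ↦ a • v)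
    (m : M) (hm : ∀ g : U, ∃ t : M, a • t = ρ (g : Γ) m - m) :
    ∃ d : contOneCocycles (subgroupRep ρ.toTopRep U),
      ∀ g, a • d.1 g = (subgroupRep ρ.toTopRep U).ρ g m - m := by
  choose t ht using hm
  have hρ : ∀ (g : U) (v : M), (subgroupRep ρ.toTopRep U).ρ g v = ρ (g : Γ) v := fun _ _ ↦ rfl
  have hcont : Continuous t := by
    rw [ha.isInducing.continuous_iff]
    have : (fun v : M ↦ a • v) ∘ t = fun g : U ↦ ρ (g : Γ) m - m := funext fun g ↦ ht g
    rw [this]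
    exact ((ρ.continuous_apply_left m).comp continuous_subtype_val).sub continuous_const
  have hmul : ∀ g h : U, t (g * h) = t g + (subgroupRep ρ.toTopRep U).ρ g (t h) := fun g h ↦ by
    apply ha.injective
    change a • t (g * h) = a • (t g + (subgroupRep ρ.toTopRep U).ρ g (t h))
    rw [smul_add, ← map_smul, ht, ht, hρ, ht, Subgroup.coe_mul, map_mul, Module.End.mul_apply,
      map_sub]
    abel
  exact ⟨⟨⟨t, hcont⟩, hmul⟩, fun g ↦ by rw [hρ]; exact ht g⟩

end Engine
/-! ## §2 One step along the tower: the trace map on `a`-torsion classes -/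

section Tower

variable {A : Type} [CommRing A] [TopologicalSpace A] {M : Type} [AddCommGroup M] [Module A M]
  [TopologicalSpace M] [IsTopologicalAddGroup M] [ContinuousSMul A M]
  (T : GaloisRep ℚ A M) {p : ℕ} [Fact p.Prime] (κ : ZpExtension ℚ p) (a : A)

omit [IsTopologicalAddGroup M] [ContinuousSMul A M] in
/-- **Stabilisation of `(M/aM)^{Γ_n}`.**  Along a `ℤ_p`-extension `κ` of `ℚ` (layers `Γ_n`), the
`A`-submodules `S_n = {m ∈ M | g m − m ∈ a • M for all g ∈ Γ_n}` of the Noetherian `M` increase with `n`,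
hence are constant from some `n₀` on: for `n ≥ n₀`, `Γ_{n+1}`-fixed modulo `a • M` implies `Γ_n`-fixed
modulo `a • M` (Kato §13.8: the `H⁰`'s stabilise). [cite: Kato2004Asterisque, §13.8 (pp. 228–229)] -/
theorem exists_forall_fixedMod_of_succ [IsNoetherian A M] :
    ∃ n₀ : ℕ, ∀ n, n₀ ≤ n → ∀ m : M,
      (∀ g ∈ κ.layerSubgroup (n + 1), ∃ t : M, a • t = T g m - m) →
        ∀ g ∈ κ.layerSubgroup n, ∃ t : M, a • t = T g m - m := by
  -- the increasing chain `S n = {m | m is Γ_n-fixed modulo a • M}` of `A`-submodules of `M`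
  let S : ℕ →o Submodule A M :=
    { toFun := fun n ↦
        { carrier := {m | ∀ g ∈ κ.layerSubgroup n, ∃ t : M, a • t = T g m - m}
          zero_mem' := fun g _ ↦ ⟨0, by rw [smul_zero, map_zero, sub_zero]⟩
          add_mem' := fun {m m'} hm hm' g hg ↦ by
            obtain ⟨t, ht⟩ := hm g hg
            obtain ⟨t', ht'⟩ := hm' g hg
            exact ⟨t + t', by rw [smul_add, ht, ht', map_add]; abel⟩
          smul_mem' := fun c m hm g hg ↦ by
            obtain ⟨t, ht⟩ := hm g hg
            exact ⟨c • t, by rw [smul_comm, ht, map_smul, smul_sub]⟩ }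
      monotone' := fun n n' hnn' m hm g hg ↦ hm g (κ.layerSubgroup_antitone hnn' hg) }
  obtain ⟨n₀, hn₀⟩ := (monotone_stabilizes_iff_noetherian.mpr inferInstance) S
  refine ⟨n₀, fun n hn m hm ↦ ?_⟩
  have hmem : m ∈ S (n + 1) := hm
  rw [← hn₀ (n + 1) (hn.trans (Nat.le_succ n)), hn₀ n hn] at hmem
  exact hmem

/-- **One step along the tower: for `n ≥ n₀` the trace map `Cor : H¹(ℚ_{n+1}, T) → H¹(ℚ_n, T)` sends
every `a`-torsion class `y` to `p • y'` with `y'` an `a`-torsion class** (`M` Noetherian over `A`, `a`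
acting by a topological embedding): `y = [c]`, `a c = ∂m`, `m` is `Γ_{n+1}`- hence `Γ_n`-fixed modulo
`a` (`exists_forall_fixedMod_of_succ`), `d = a⁻¹∂m` is a cocycle on `Γ_n` with `res [d] = y`, `a [d] = 0`,
so `Cor y = Cor res [d] = (Γ_n : Γ_{n+1}) [d] = p [d]` (`coresLe_resLe`).  Kato §13.8, levelwise, for a
general coefficient ring. [cite: Kato2004Asterisque, Thm. 12.4 (2) (p. 221) and §13.8 (pp. 228–229)] -/
theorem exists_forall_layerCores_eq_smul [IsNoetherian A M] (ha : IsEmbedding fun v : M ↦ a • v) :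
    ∃ n₀ : ℕ, ∀ n, n₀ ≤ n → ∀ y : H1 T (κ.layerSubgroup (n + 1)), a • y = 0 →
      ∃ y' : H1 T (κ.layerSubgroup n), a • y' = 0 ∧ layerCores T κ n y = (p : A) • y' := by
  have hp : p.Prime := Fact.out
  obtain ⟨n₀, hn₀⟩ := exists_forall_fixedMod_of_succ T κ a
  refine ⟨n₀, fun n hn y hy ↦ ?_⟩
  have hle : κ.layerSubgroup (n + 1) ≤ κ.layerSubgroup n := κ.layerSubgroup_antitone (Nat.le_succ n)
  have hρ : ∀ (k : ℕ) (g : κ.layerSubgroup k) (v : M),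
      (subgroupRep T.toTopRep (κ.layerSubgroup k)).ρ g v = T (g : absoluteGaloisGroup ℚ) v :=
    fun _ _ _ ↦ rfl
  -- `y = [c]`, `a • c = ∂m`
  obtain ⟨c, hc⟩ := oneCocycleClass_surjective _ y
  have hy' : oneCocycleClass _ (a • c) = 0 := by rw [oneCocycleClass_smul, hc]; exact hy
  rw [oneCocycleClass_eq_zero_iff] at hy'
  obtain ⟨m, hm⟩ := hy'
  have hm' : ∀ g : κ.layerSubgroup (n + 1),
      a • c.1 g = T (g : absoluteGaloisGroup ℚ) m - m := fun g ↦ by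
    rw [← hρ, ← hm g, Submodule.coe_smul, ContinuousMap.smul_apply]
  -- `m` is `Γ_{n+1}`-fixed modulo `a`, hence `Γ_n`-fixed modulo `a`
  have hfix : ∀ g ∈ κ.layerSubgroup n, ∃ t : M, a • t = T g m - m :=
    hn₀ n hn m fun g hg ↦ ⟨c.1 ⟨g, hg⟩, hm' ⟨g, hg⟩⟩
  -- `d = a⁻¹ ∂m`, a continuous cocycle on `Γ_n`
  obtain ⟨d, hd⟩ := exists_contOneCocycles_smul_eq_coboundary T (κ.layerSubgroup n) a ha m
    fun g ↦ hfix g g.2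
  -- `res [d] = [c]`
  have hdc : ∀ g : κ.layerSubgroup (n + 1), d.1 (subgroupInclusion hle g) = c.1 g := fun g ↦ by
    apply ha.injective
    change a • d.1 (subgroupInclusion hle g) = a • c.1 g
    rw [hd, hm', hρ, subgroupInclusion_apply_coe]
  have hres : resLe T.toTopRep hle 1 (oneCocycleClass _ d) = oneCocycleClass _ c :=
    resLe_oneCocycleClass_eq_of_forall_apply T.toTopRep hle d c hdc
  -- `a • [d] = [∂m] = 0`
  have had : a • oneCocycleClass _ d = 0 := by
    rw [← oneCocycleClass_smul, oneCocycleClass_eq_zero_iff]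
    exact ⟨m, fun g ↦ by rw [Submodule.coe_smul, ContinuousMap.smul_apply, hd g]⟩
  -- `Cor [c] = Cor res [d] = (Γ_n : Γ_{n+1}) • [d] = p • [d]`
  have hidx : ((κ.layerSubgroup (n + 1)).subgroupOf (κ.layerSubgroup n)).index = p := by
    have h1 := Subgroup.relIndex_mul_index hle
    rw [ZpExtension.index_layerSubgroup, ZpExtension.index_layerSubgroup, pow_succ'] at h1
    exact Nat.eq_of_mul_eq_mul_right (pow_pos hp.pos n) h1
  refine ⟨oneCocycleClass _ d, had, ?_⟩
  rw [← hc, ← hres]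
  unfold layerCores
  rw [coresLe_resLe, hidx]

end Tower

end IwasawaH1CoeffTorsionFree

/-! ## §3 `𝐇¹_Γ(T)` over `A⟦X⟧` has no `a`-torsion -/

namespace IwasawaH1DataCoeff

section General

variable {A : Type} [CommRing A] [TopologicalSpace A] {M : Type} [AddCommGroup M] [Module A M]
  [TopologicalSpace M] [IsTopologicalAddGroup M] [ContinuousSMul A M]
  {T : GaloisRep ℚ A M} {p : ℕ} [Fact p.Prime] {κ : ZpExtension ℚ p} {γ : absoluteGaloisGroup ℚ}

/-- **Kato Thm. 12.4 (2), constant part, for a general coefficient ring: `𝐇¹_Γ(T)` has no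
`a`-torsion.**  Let `T` be a continuous representation of `Γ_ℚ` on a Noetherian `A`-module `M`, `κ` a
`ℤ_p`-extension of `ℚ`, `I : IwasawaH1DataCoeff T p κ γ` ANY pin of `𝐇¹_Γ(T) = lim←_n H¹(ℤ_n[1/p], T)`
over `A⟦X⟧`, and `a ∈ A` a scalar acting on `M` by a topological embedding with `p^k ∈ (a)` for some `k`.
Then `C(a) • x = 0 → x = 0`: the components `x_n = proj n x` are norm-compatible `a`-torsion classes, so
iterating `exists_forall_layerCores_eq_smul` gives `x_n = p^j • z` with `a z = 0` for every `j` (`n ≥ n₀`),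
whence `x_n = p^k • z = b • (a • z) = 0`; then `x_n = 0` for all `n` along `Cor`, and `(proj n)_n` is
injective.  Kato Thm. 12.4 (2) "`𝐇¹(T)` is a torsion free `Λ`-module", the part concerning constants, with
no hypothesis on `T`. [cite: Kato2004Asterisque, Thm. 12.4 (2) (p. 221) and §13.8 (pp. 228–229)] -/
theorem eq_zero_of_C_smul_eq_zero [IsNoetherian A M] (I : IwasawaH1DataCoeff T p κ γ) {a : A}
    (ha : IsEmbedding fun v : M ↦ a • v) {k : ℕ} (hk : (p : A) ^ k ∈ Ideal.span {a})
    (x : I.H) (hx : (PowerSeries.C a : PowerSeries A) • x = 0) : x = 0 := by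
  obtain ⟨n₀, hn₀⟩ := IwasawaH1CoeffTorsionFree.exists_forall_layerCores_eq_smul T κ a ha
  -- every component is `a`-torsion
  have htors : ∀ n, a • I.proj n x = 0 := fun n ↦ by
    rw [← I.proj_C_smul a n x, hx, map_zero]
  -- for `n ≥ n₀`, `x_n` is `p^j • (an a-torsion class)` for every `j`
  have hdiv : ∀ j n, n₀ ≤ n → ∃ z : H1 T (κ.layerSubgroup n), a • z = 0 ∧
      I.proj n x = (p : A) ^ j • z := by
    intro j
    induction j with
    | zero => exact fun n _ ↦ ⟨I.proj n x, htors n, by rw [pow_zero, one_smul]⟩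
    | succ j ih =>
      intro n hn
      obtain ⟨z, hz, hxz⟩ := ih (n + 1) (hn.trans (Nat.le_succ n))
      obtain ⟨z', hz', hzz'⟩ := hn₀ n hn z hz
      refine ⟨z', hz', ?_⟩
      rw [← I.cores_proj n x, hxz, map_smul, hzz', smul_smul, pow_succ]
  -- hence `x_n = 0` for `n ≥ n₀` (`p^k = b a`)
  have hge : ∀ n, n₀ ≤ n → I.proj n x = 0 := fun n hn ↦ by
    obtain ⟨z, hz, hxz⟩ := hdiv k n hn
    obtain ⟨b, hb⟩ := Ideal.mem_span_singleton'.mp hk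
    rw [hxz, ← hb, mul_smul, hz, smul_zero]
  -- then everywhere (downwards along the trace maps)
  have hall : ∀ m n, n₀ ≤ n + m → I.proj n x = 0 := by
    intro m
    induction m with
    | zero => exact fun n hn ↦ hge n (by simpa using hn)
    | succ m ih =>
      intro n hn
      rw [← I.cores_proj n x, ih (n + 1) (by omega), map_zero]
  exact I.proj_injective x fun n ↦ hall n₀ n (Nat.le_add_left n₀ n)

/-- **`C(a)` is `𝐇¹_Γ(T)`-regular** (the `IsSMulRegular` form of `eq_zero_of_C_smul_eq_zero`: under
the same hypotheses, `x ↦ C(a) • x` is injective on `𝐇¹_Γ(T)`).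
[cite: Kato2004Asterisque, Thm. 12.4 (2) (p. 221)] -/
theorem isSMulRegular_C [IsNoetherian A M] (I : IwasawaH1DataCoeff T p κ γ) {a : A}
    (ha : IsEmbedding fun v : M ↦ a • v) {k : ℕ} (hk : (p : A) ^ k ∈ Ideal.span {a}) :
    IsSMulRegular I.H (PowerSeries.C a : PowerSeries A) := fun x y hxy ↦ by
  rw [← sub_eq_zero]
  refine I.eq_zero_of_C_smul_eq_zero ha hk (x - y) ?_
  rw [smul_sub, sub_eq_zero]
  exact hxy

end General
end IwasawaH1DataCoeff

/-! ## §4 The coefficient ring `𝒪 = padicCoeffIntegers S` of a finite `ℚ_p(S)/ℚ_p` -/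

namespace IwasawaH1CoeffTorsionFree

variable {p : ℕ} [Fact p.Prime] (S : Set (PadicAlgCl p))

/-- `‖p‖ < 1` in `ℚ̄_p` (`|p|_p = 1/p`). [folklore] -/
private theorem norm_natCast_prime_lt_one : ‖((p : ℕ) : PadicAlgCl p)‖ < 1 := by
  have hp : p.Prime := Fact.out
  have h : ‖((p : ℕ) : PadicAlgCl p)‖₊ = 1 / (p : NNReal) := by
    rw [← PadicAlgCl.valuation_def]; exact PadicAlgCl.valuation_p p
  rw [← coe_nnnorm, h, NNReal.coe_div, NNReal.coe_one, NNReal.coe_natCast,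
    div_lt_one (by exact_mod_cast hp.pos)]
  exact_mod_cast hp.one_lt

/-- **Every non-zero `a ∈ 𝒪` divides a power of `p`** (`𝒪 = {x ∈ ℚ_p(S) : ‖x‖ ≤ 1}` the ring of
integers of `ℚ_p(S) ⊆ ℚ̄_p`, EPW §3.1): choose `k` with `‖p‖^k ≤ ‖a‖`; then `p^k / a ∈ ℚ_p(S)` has norm
`≤ 1`, i.e. lies in `𝒪`. [cite: EmertonPollackWeston2006, §3.1 (arXiv:math/0404484 p. 17)] -/
theorem exists_pow_natCast_mem_span {a : padicCoeffIntegers S} (ha : a ≠ 0) :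
    ∃ k : ℕ, ((p : ℕ) : padicCoeffIntegers S) ^ k ∈ Ideal.span {a} := by
  have ha' : (a : PadicAlgCl p) ≠ 0 := fun h ↦ ha (Subtype.ext h)
  obtain ⟨k, hk⟩ := exists_pow_lt_of_lt_one (norm_pos_iff.mpr ha') (norm_natCast_prime_lt_one (p := p))
  refine ⟨k, Ideal.mem_span_singleton'.mpr ?_⟩
  have hmemK : ((p : ℕ) : PadicAlgCl p) ^ k / (a : PadicAlgCl p) ∈ padicCoeffField S :=
    div_mem (pow_mem (natCast_mem _ p) k) a.2.1
  have hnorm : ‖((p : ℕ) : PadicAlgCl p) ^ k / (a : PadicAlgCl p)‖ ≤ 1 := by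
    rw [norm_div, norm_pow, div_le_one (norm_pos_iff.mpr ha')]; exact hk.le
  refine ⟨⟨_, hmemK, hnorm⟩, Subtype.ext ?_⟩
  change ((p : ℕ) : PadicAlgCl p) ^ k / (a : PadicAlgCl p) * (a : PadicAlgCl p) =
    (((((p : ℕ) : padicCoeffIntegers S) ^ k : padicCoeffIntegers S)) : PadicAlgCl p)
  rw [div_mul_cancel₀ _ ha', Subring.coe_pow, Subring.coe_natCast]

/-- **Multiplication by a non-zero `a ∈ 𝒪` is a topological embedding of `𝒪ⁿ`**: on each
coordinate it is the restriction to the subring `𝒪 ⊆ ℚ̄_p` of the homeomorphism `y ↦ a y` of the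
normed field `ℚ̄_p`, and a product of embeddings is an embedding. [folklore] -/
private theorem isEmbedding_smul_pi {a : padicCoeffIntegers S} (ha : a ≠ 0) (n : ℕ) :
    IsEmbedding fun v : (Fin n → padicCoeffIntegers S) ↦ a • v := by
  have ha' : (a : PadicAlgCl p) ≠ 0 := fun h ↦ ha (Subtype.ext h)
  have hval : IsEmbedding (Subtype.val : padicCoeffIntegers S → PadicAlgCl p) :=
    IsEmbedding.subtypeVal
  have hmul : IsEmbedding (fun y : PadicAlgCl p ↦ (a : PadicAlgCl p) * y) :=
    (Homeomorph.mulLeft₀ (a : PadicAlgCl p) ha').isEmbedding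
  have h1 : IsEmbedding (fun x : padicCoeffIntegers S ↦ a * x) := by
    rw [← hval.of_comp_iff]
    exact hmul.comp hval
  exact IsEmbedding.piMap fun _ : Fin n ↦ h1

end IwasawaH1CoeffTorsionFree

/-! ## §5 `𝐇¹_Γ(T_ρ)` has no `𝒪`-torsion for a lattice `ρ : Γ_ℚ → GL_n(𝒪)` -/

namespace IwasawaH1DataCoeff

section PadicCoeff

variable {p : ℕ} [Fact p.Prime] {S : Set (PadicAlgCl p)} {n : ℕ}
  {ρ : FramedGaloisRep ℚ (padicCoeffIntegers S) n} {κ : ZpExtension ℚ p} {γ : absoluteGaloisGroup ℚ}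

/-- **Kato Thm. 12.4 (2), constant part, for `𝒪_λ`-lattices: `𝐇¹_Γ(T_ρ)` has no `𝒪`-torsion.**  For
`𝒪 = padicCoeffIntegers S` the ring of integers of a FINITE extension `ℚ_p(S)` of `ℚ_p` inside `ℚ̄_p`,
every continuous `ρ : Γ_ℚ → GL_n(𝒪)` (`T_ρ = 𝒪ⁿ`), every prime `p`, every `ℤ_p`-extension `κ` of `ℚ`,
every `γ` and EVERY pin `I : IwasawaH1DataCoeff ρ.toGaloisRep p κ γ` of `𝐇¹_Γ(T_ρ)` over `Λ_𝒪 = 𝒪⟦X⟧`: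
if `a ∈ 𝒪` is non-zero and `C(a) • x = 0` then `x = 0` (`eq_zero_of_C_smul_eq_zero` with §4: `𝒪ⁿ` is
Noetherian, `a •` an embedding, `a ∣ p^k`).  No hypothesis on `ρ` (no newform / irreducibility input).
[cite: Kato2004Asterisque, Thm. 12.4 (2) (p. 221) and §13.8 (pp. 228–229)] -/
theorem eq_zero_of_C_smul_eq_zero_of_ne_zero [FiniteDimensional ℚ_[p] (padicCoeffField S)]
    (I : IwasawaH1DataCoeff ρ.toGaloisRep p κ γ) {a : padicCoeffIntegers S} (ha : a ≠ 0)
    (x : I.H) (hx : (PowerSeries.C a : IwasawaAlgebraO S) • x = 0) : x = 0 := by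
  haveI : IsPrincipalIdealRing (padicCoeffIntegers S) := isPrincipalIdealRing_padicCoeffIntegers S
  obtain ⟨k, hk⟩ := IwasawaH1CoeffTorsionFree.exists_pow_natCast_mem_span S ha
  exact I.eq_zero_of_C_smul_eq_zero (IwasawaH1CoeffTorsionFree.isEmbedding_smul_pi S ha n) hk x hx

/-- **`C(a)` is `𝐇¹_Γ(T_ρ)`-regular for every non-zero `a ∈ 𝒪`** (injectivity of `x ↦ C(a) • x`; the
`IsSMulRegular` form of `eq_zero_of_C_smul_eq_zero_of_ne_zero`).
[cite: Kato2004Asterisque, Thm. 12.4 (2) (p. 221)] -/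
theorem isSMulRegular_C_of_ne_zero [FiniteDimensional ℚ_[p] (padicCoeffField S)]
    (I : IwasawaH1DataCoeff ρ.toGaloisRep p κ γ) {a : padicCoeffIntegers S} (ha : a ≠ 0) :
    IsSMulRegular I.H (PowerSeries.C a : IwasawaAlgebraO S) := fun x y hxy ↦ by
  rw [← sub_eq_zero]
  refine I.eq_zero_of_C_smul_eq_zero_of_ne_zero ha (x - y) ?_
  rw [smul_sub, sub_eq_zero]
  exact hxy

/-- **`𝐇¹_Γ(T_ρ)` is a TORSION-FREE `𝒪`-MODULE** for the `𝒪`-module structure obtained by restricting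
the scalars of the pin along `C : 𝒪 → 𝒪⟦X⟧` (`Module.compHom`, as in the pin's `projₗ`): every regular
(= non-zero) `a ∈ 𝒪` acts injectively — the `𝒪`-half of "`𝐇¹(T)` is a torsion free `Λ`-module".
[cite: Kato2004Asterisque, Thm. 12.4 (2) (p. 221) and §13.8 (p. 228)] -/
theorem isTorsionFree_compHom_C [FiniteDimensional ℚ_[p] (padicCoeffField S)]
    (I : IwasawaH1DataCoeff ρ.toGaloisRep p κ γ) :
    letI : Module (padicCoeffIntegers S) I.H :=
      Module.compHom I.H (PowerSeries.C (R := padicCoeffIntegers S))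
    Module.IsTorsionFree (padicCoeffIntegers S) I.H := by
  letI : Module (padicCoeffIntegers S) I.H :=
    Module.compHom I.H (PowerSeries.C (R := padicCoeffIntegers S))
  refine ⟨fun a ha ↦ ?_⟩
  have ha0 : a ≠ 0 := by
    rintro rfl
    exact not_isRegular_zero ha
  intro x y hxy
  exact I.isSMulRegular_C_of_ne_zero ha0 hxy

end PadicCoeff

/-! ## §6 On the binders of the named fact `thm12_4_newform` (K0b) -/

section Newform

open CongruenceSubgroup Literature.NumberTheory.EllipticCurves.ModularForms

/-- **Kato Thm. 12.4 (2), constant part, on the binders of `Kato2004.thm12_4_newform`.**  For every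
prime `p`, level `M`, `g ∈ S₂(Γ₀(M))` with `IsNewform0 g`, embedding `ι : K_g → ℚ̄_p`, lattice
`ρ : Γ_ℚ → GL₂(𝒪)` (`𝒪 = padicCoeffIntegers (Set.range ι)`), `ℤ_p`-extension `κ`, `γ`, and every datum
`I : IwasawaH1DataCoeff ρ.toGaloisRep p κ γ`: a non-zero CONSTANT `a ∈ 𝒪 ⊂ Λ_𝒪` is not a zero-divisor on
`I.H = 𝐇¹_Γ(T_ρ)` — the sub-clause of `Module.IsTorsionFree Λ_𝒪 I.H` in `thm12_4_newform` concerning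
constants, unconditionally (`K_g` is a number field; the Frobenius / cyclotomicity hypotheses of the fact
are not taken).  The distinguished-polynomial half, (12.2.1) and the rank remain the named fact.
[cite: Kato2004Asterisque, Thm. 12.4 (2) (p. 221) and §13.8 (pp. 228–229)] -/
theorem eq_zero_of_C_smul_eq_zero_newform {p : ℕ} [Fact p.Prime] {M : ℕ} [NeZero M]
    {g : CuspForm (Gamma0 M) 2} (ι : coeffField g →+* PadicAlgCl p)
    {ρ : FramedGaloisRep ℚ (padicCoeffIntegers (Set.range ι)) 2}
    {κ : ZpExtension ℚ p} {γ : absoluteGaloisGroup ℚ} (hg : IsNewform0 g)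
    (I : IwasawaH1DataCoeff ρ.toGaloisRep p κ γ) {a : padicCoeffIntegers (Set.range ι)} (ha : a ≠ 0)
    (x : I.H) (hx : (PowerSeries.C a : IwasawaAlgebraO (Set.range ι)) • x = 0) : x = 0 := by
  haveI : FiniteDimensional ℚ (coeffField g) := IsNewform0.finiteDimensional_coeffField_holds hg
  haveI : FiniteDimensional ℚ_[p] (padicCoeffField (Set.range ι)) :=
    GreenbergSelmer.finiteDimensional_padicCoeffField ι
  exact I.eq_zero_of_C_smul_eq_zero_of_ne_zero ha x hx

end Newform

end IwasawaH1DataCoeff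

end Literature.NumberTheory.EllipticCurves.Kato2004

end
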